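import Literature.NumberTheory.GaloisRepresentations.IdeleClassBarSRelativeLayers
import Literature.NumberTheory.GaloisRepresentations.IdeleClassModUnitsSCoprimeKilling
import Literature.Algebra.Homology.CoinducedConjugation
import Literature.GroupTheory.ProfiniteSubquotients
import HarnessLib

/-!
# Every class of `Extʳ_{C_{↥W}}(ℤ, Res_W C̄_S)`, `r ≥ 3`, is killed by an integer prime to `p` (`W ≤ G_S` open, `S ⊇ S_p`) — Harari Lemma 16.20 at `p` for `(G_S, C_S)`

Topic `NumberTheory/GaloisRepresentations`; namespace `Literature.NumberTheory.GaloisRepresentations.IdeleClassBar`.  Theorems only; no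
definition, no named fact, no instance, no `sorry`.  Sequel of bsd-line-x1-p1-w3's `IdeleClassBarSRelativeLayers` (the relative
layers `(Res_W C̄_S)^{V̄_E ∩ W}` of `C̄_S = lim→ C_S(E)` at a subgroup `W ≤ G_S` and `relLayerSCohomologyIso :
Hⁿ(↥W ⧸ (V̄_E ∩ W), (Res_W C̄_S)^{V̄_E ∩ W}) ≅ Hⁿ(H_E, Res_{H_E} C_S(E))`, `H_E = {σ|_E : [σ] ∈ W}`) and of
`IdeleClassModUnitsSCoprimeKilling` (the per-layer Tate–Nakayama step at `p`: the prime-to-`p` part of `Hⁿ⁺³(H_E, C_S(E))` dies in a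
cyclotomic layer `M ⊆ K_S`; the generic annihilation lemma `LayerColimit.exists_coprime_nsmul_eq_zero_ext_res_of_forall_trace`).
Written for the background lane «PT-Ш-S-TC» of crux `GoodLatticeBDPValue` (stmt-BirchSwinnertonDyer-19032, cell `bsd-eis`), brick
D2-TN: it supplies field (8) `ext_triv_coprime` (degrees `r ≥ 3`, at every open normal `U ≤ G_S`) of
`DiscreteRep.tateDualityHypothesesAt_of_coprime` for `C = classBarSD K S` — hence `ext_triv_divisible (r ≥ 3)` and
`ext_triv_eq_zero_of_nsmul_eq_zero` of door-c4's engine `TateDualityHypothesesAt p (classBarSD K S) inv_S`.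
HONEST FRAMING: Galois cohomology of the `S`-idèle classes (a `P`-class formation property at `p ∈ P`); no duality theorem and no case
of BSD is proved here.

THE STATEMENT IN PRINT.  Harari, Lemma 16.20 (with Remark 16.24 (b) and Remark 17.1: `(G_S, C_S)` is a `P`-class formation for the
set `P ⊇ {ℓ : S ⊇ S_ℓ}`): for `r ≥ 3` the groups `Hʳ(U, C)` (`U ≤ G` open) have no `ℓ`-primary part for `ℓ ∈ P` — "if `α` is
`m`-torsion with `m` a power of `ℓ ∈ P` … the image of `α` in `Hʳ(G/V, C^V)` is zero".  Equivalently (finite layers have finite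
exponent): every class of `Hʳ(U, C_S)`, `r ≥ 3`, is killed by an integer prime to `p`.  NSW (8.3.8)–(8.3.11).

## What is formalised (`K` a number field, `S : Finset`, `G_S = GaloisGroupUnramifiedOutside K ↑S`, `W : Subgroup G_S`)

* §1 the relative transition square (along w3's `res = subgroupImageSRes : H_M → H_E` and ANY pair morphism `j'` over it with
  the underlying map of `classModUnitsInflHom K E M S`): `quotMap_comp_subgroupImageSEquiv_symm_eq_comp_subgroupImageSRes` (groups),
  **`relLayerSEquiv_invariantsStepIncl_eq_hom`** (vectors, from w3's generator formula `relLayerSEquiv_invariantsStepIncl`),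
  **`stepG_comp_relLayerSCohomologyIso_eq_comp_map`** / `relLayerSCohomologyIso_hom_stepG_eq_map`: door-c4's `stepG` between the relative layers at
  `E ≤ M` is, under w3's isomorphisms, the relative inflation `map res j'` of the `S`-idèle classes (Serre I §2.2 Prop. 8; NSW (8.3.8)).
* §2 **`exists_coprime_nsmul_stepG_trace_eq_zero`**: for `S ⊇ S_p`, every class `c` of a trace layer
  `Hⁿ⁺³(↥W ⧸ (V ∩ W), (Res_W C̄_S)^{V ∩ W})` (`V ≤ W` open normal in `G_S`) has a multiple `d · c`, `p ∤ d`, killed by the transition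
  to the trace of some layer subgroup `V̄_M ≤ V`.
* §3 **`exists_coprime_nsmul_eq_zero_ext_triv_res_classBarSD`** (`W ≤ G_S` open) and **`ext_triv_coprime_classBarSD`**
  (`U : OpenNormalSubgroup G_S`, the binder of `tateDualityHypothesesAt_of_coprime`): every
  `x ∈ Extʳ_{C_{↥U}}(ℤ, Res_U C̄_S)`, `r ≥ 3`, has `d · x = 0` for some `d` prime to `p`.

## References
* D. Harari, *Galois Cohomology and Class Field Theory*, Universitext, Springer (2020), §16.3 Lemma 16.20, Remark 16.24 (b), §17.1
  Remark 17.1, Theorem 17.2. [Harari2020]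
* J. Neukirch, A. Schmidt, K. Wingberg, *Cohomology of Number Fields*, 2nd ed. (2008), VIII §3 (8.3.8)–(8.3.11). [NeukirchSchmidtWingberg2008]
* J.-P. Serre, *Galois Cohomology*, Springer (1997), I §2.2 Proposition 8. [SerreGaloisCohomology1997]
-/

noncomputable section

open NumberField IsDedekindDomain CategoryTheory CategoryTheory.Limits CategoryTheory.Abelian groupCohomology
open Field (absoluteGaloisGroup)
open Literature.Algebra.Homology Literature.Algebra.Homology.DiscreteRep Literature.NumberTheory.Automorphic
open Literature.NumberTheory.GaloisRepresentations.LocalWeilDatum (galFixing)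

namespace Literature.NumberTheory.GaloisRepresentations

namespace IdeleClassBar

variable {K : Type} [Field K] [NumberField K] (S : Finset (HeightOneSpectrum (𝓞 K)))

/-! ## §1. The relative transition square: `stepG` between the relative layers is the relative inflation of the `S`-idèle classes -/

section Square

variable {W : Subgroup (GaloisGroupUnramifiedOutside K (↑S : Set (HeightOneSpectrum (𝓞 K))))} {E M : GalLayer K} (h : E ≤ M)
  (hE : ramificationSubgroup K (↑S : Set (HeightOneSpectrum (𝓞 K))) ≤ galFixing K E.1)
  (hM : ramificationSubgroup K (↑S : Set (HeightOneSpectrum (𝓞 K))) ≤ galFixing K M.1)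

/-- **The groups**: `quotMap ∘ (↥W ⧸ (V̄_M ∩ W) ≃* H_M)⁻¹ = (↥W ⧸ (V̄_E ∩ W) ≃* H_E)⁻¹ ∘ res` on `H_M` (both send `w|_M` to `[w]`;
w3's `subgroupImageSRes_toSubgroupImageS`). [cite: SerreGaloisCohomology1997, I §2.2 Proposition 8] -/
theorem quotMap_comp_subgroupImageSEquiv_symm_eq_comp_subgroupImageSRes :
    (DiscreteRep.quotMap
          (DiscreteRep.traceOpenNormalSubgroup W (layerSubgroupS S E) : Subgroup W)
          (DiscreteRep.traceOpenNormalSubgroup W (layerSubgroupS S M) : Subgroup W)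
          (DiscreteRep.traceOpenNormalSubgroup_mono W (layerSubgroupS_anti S h))).comp
        (subgroupImageSEquiv S hM W).symm.toMonoidHom =
      (subgroupImageSEquiv S hE W).symm.toMonoidHom.comp (subgroupImageSRes S W h hE hM) := by
  refine MonoidHom.ext fun τ => ?_
  have hw := toSubgroupImageS_surjective S hM W τ
  obtain ⟨w, rfl⟩ := hw
  have h1 : (subgroupImageSEquiv S hM W).symm (toSubgroupImageS S hM W w) = QuotientGroup.mk w :=
    (MulEquiv.symm_apply_eq _).2 (subgroupImageSEquiv_mk S hM W w).symm
  have h2 : (subgroupImageSEquiv S hE W).symm (toSubgroupImageS S hE W w) = QuotientGroup.mk w :=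
    (MulEquiv.symm_apply_eq _).2 (subgroupImageSEquiv_mk S hE W w).symm
  rw [MonoidHom.comp_apply, MonoidHom.comp_apply, MulEquiv.coe_toMonoidHom, MulEquiv.coe_toMonoidHom,
    subgroupImageSRes_toSubgroupImageS S W h hE hM w, h1, h2, DiscreteRep.quotMap_mk]

variable (hEW : (layerSubgroupS S E : Subgroup (GaloisGroupUnramifiedOutside K (↑S : Set (HeightOneSpectrum (𝓞 K))))) ≤ W)
  (hMW : (layerSubgroupS S M : Subgroup (GaloisGroupUnramifiedOutside K (↑S : Set (HeightOneSpectrum (𝓞 K))))) ≤ W)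
  (j' : haveI := E.numberField; haveI := M.numberField;
    Rep.res (subgroupImageSRes S W h hE hM)
        (Rep.res (subgroupImageS S hE W).subtype (IdeleCohomology.classModUnitsRep K E.1 S)) ⟶
      Rep.res (subgroupImageS S hM W).subtype (IdeleCohomology.classModUnitsRep K M.1 S))
  (hj' : haveI := E.numberField; haveI := M.numberField; haveI := E.isGalois; letI := GalLayer.algebraOfLE h;
    haveI := GalLayer.isScalarTower_of_le h;
    ∀ z : (IdeleCohomology.classModUnitsRep K E.1 S).V, j'.hom z = (IdeleCohomology.classModUnitsInflHom K E.1 M.1 S).hom z)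

include hj' in
set_option maxHeartbeats 800000 in
-- the substitution `z = relToLayerS⁻¹ [x]` and the rewrites run through the `ℤ`-instance paths of three layer objects
/-- **The vectors, on every element**: under w3's `relLayerSEquiv`s, door-c4's inclusion `(Res_W C̄_S)^{V̄_E ∩ W} ⊆ (Res_W C̄_S)^{V̄_M ∩ W}`
is any pair morphism `j'` over `res` with the underlying map of the inflation `C_S(E) → C_S(M)` (w3's
`relLayerSEquiv_invariantsStepIncl` on generators `[x]_E`, `π_transHom_eq_classModUnitsInflHom`).
[cite: NeukirchSchmidtWingberg2008, VIII §3 (8.3.8)–(8.3.9)][cite: Harari2020, §17.4 (17.1)] -/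
theorem relLayerSEquiv_invariantsStepIncl_eq_hom (z : (relLayerRepS S W E).V) :
    haveI := E.numberField; haveI := M.numberField;
    relLayerSEquiv S hM hMW
        ((DiscreteRep.invariantsStepIncl
          (DiscreteRep.traceOpenNormalSubgroup W (layerSubgroupS S E) : Subgroup W)
          (DiscreteRep.traceOpenNormalSubgroup W (layerSubgroupS S M) : Subgroup W)
          (DiscreteRep.traceOpenNormalSubgroup_mono W (layerSubgroupS_anti S h))
          ((DiscreteRep.resD ℤ W).obj (classBarSD K S))).hom z) =
      j'.hom (relLayerSEquiv S hE hEW z) := by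
  haveI := E.numberField
  haveI := M.numberField
  haveI := E.isGalois
  letI := GalLayer.algebraOfLE h
  haveI := GalLayer.isScalarTower_of_le h
  have hz := exists_relToLayerS_symm_toLayerS_eq S hE hEW z
  obtain ⟨x, hx⟩ := hz
  -- `iso_E z = π_E x` and `iso_M (incl z) = π_M (x_M)`
  have h2 : relLayerSEquiv S hE hEW z =
      (cokernel.π (IdeleCohomology.unitsOffToClass (F := K) (E := E.1) S)).hom x := by
    rw [← hx]
    exact relLayerSEquiv_symm_toLayerS S hE hEW x
  have h1 : relLayerSEquiv S hM hMW
      ((DiscreteRep.invariantsStepIncl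
        (DiscreteRep.traceOpenNormalSubgroup W (layerSubgroupS S E) : Subgroup W)
        (DiscreteRep.traceOpenNormalSubgroup W (layerSubgroupS S M) : Subgroup W)
        (DiscreteRep.traceOpenNormalSubgroup_mono W (layerSubgroupS_anti S h))
        ((DiscreteRep.resD ℤ W).obj (classBarSD K S))).hom z) =
      (cokernel.π (IdeleCohomology.unitsOffToClass (F := K) (E := M.1) S)).hom (transHom E M h x) := by
    rw [← hx]
    exact relLayerSEquiv_invariantsStepIncl S h hE hM hEW x
  rw [h1, h2, hj', π_transHom_eq_classModUnitsInflHom S h]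

include hj' in
set_option maxHeartbeats 800000 in
-- as in bsd-line-x1-p1-w5's `stepG_comp_layerSCohomologyIso`: two `groupCohomology.map` composites compared through `map_comp` /
-- `map_congr'`; the `ℤ`-instance paths of the layer objects make the unification slow
/-- **`stepG (V̄_E ∩ W) (V̄_M ∩ W) ≫ iso_M = iso_E ≫ map res j'`**: door-c4's transition between the relative layers of `C̄_S` at `W` is,
under w3's `relLayerSCohomologyIso`s, the relative inflation `Hⁿ(H_E, C_S(E)) → Hⁿ(H_M, C_S(M))` along `res : H_M → H_E` and any pair
morphism `j'` over it with the underlying map of `classModUnitsInflHom K E M S` (Mathlib `groupCohomology.map_comp`, the cell's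
`map_congr'`). [cite: SerreGaloisCohomology1997, I §2.2 Proposition 8][cite: NeukirchSchmidtWingberg2008, VIII §3 (8.3.8)] -/
theorem stepG_comp_relLayerSCohomologyIso_eq_comp_map (n : ℕ) :
    haveI := E.numberField; haveI := M.numberField;
    LayerColimit.stepG (DiscreteRep.traceOpenNormalSubgroup W (layerSubgroupS S E))
        (DiscreteRep.traceOpenNormalSubgroup W (layerSubgroupS S M))
        (DiscreteRep.traceOpenNormalSubgroup_mono W (layerSubgroupS_anti S h))
        ((DiscreteRep.resD ℤ W).obj (classBarSD K S)) n ≫ (relLayerSCohomologyIso S hM hMW n).hom =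
      (relLayerSCohomologyIso S hE hEW n).hom ≫ groupCohomology.map (subgroupImageSRes S W h hE hM) j' n := by
  haveI := E.numberField
  haveI := M.numberField
  rw [relLayerSCohomologyIso, relLayerSCohomologyIso, groupCohomology.mapIso_hom, groupCohomology.mapIso_hom,
    ← groupCohomology.map_comp, ← groupCohomology.map_comp]
  refine Literature.Algebra.Homology.map_congr' (quotMap_comp_subgroupImageSEquiv_symm_eq_comp_subgroupImageSRes S h hE hM) _ _ (fun z => ?_) n
  exact relLayerSEquiv_invariantsStepIncl_eq_hom S h hE hM hEW hMW j' hj' z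

include hj' in
/-- Elementwise form of the square. [cite: SerreGaloisCohomology1997, I §2.2 Proposition 8][cite: NeukirchSchmidtWingberg2008, VIII §3 (8.3.8)] -/
theorem relLayerSCohomologyIso_hom_stepG_eq_map (n : ℕ)
    (c : groupCohomology (relLayerRepS S W E) n) :
    haveI := E.numberField; haveI := M.numberField;
    (relLayerSCohomologyIso S hM hMW n).hom
        (LayerColimit.stepG (DiscreteRep.traceOpenNormalSubgroup W (layerSubgroupS S E))
          (DiscreteRep.traceOpenNormalSubgroup W (layerSubgroupS S M))
          (DiscreteRep.traceOpenNormalSubgroup_mono W (layerSubgroupS_anti S h))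
          ((DiscreteRep.resD ℤ W).obj (classBarSD K S)) n c) =
      groupCohomology.map (subgroupImageSRes S W h hE hM) j' n ((relLayerSCohomologyIso S hE hEW n).hom c) := by
  have hsq := congrArg (fun φ => φ c) (stepG_comp_relLayerSCohomologyIso_eq_comp_map S h hE hM hEW hMW j' hj' n)
  simpa only [ModuleCat.comp_apply] using hsq

end Square

/-! ## §2. The prime-to-`p` part of every trace-layer class dies in a deeper layer -/

variable (p : ℕ) [hp : Fact p.Prime]

set_option maxHeartbeats 800000 in
-- `stepG_stepG` / `relLayerSCohomologyIso_hom_stepG_eq_map` rewrites between the relative layer objects (slow instance unification)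
/-- **Lemma 16.20 at `p`, per layer, for `C̄_S` at an open subgroup `W ≤ G_S`** (`S ⊇ S_p`): every class `c` of a trace layer
`Hⁿ⁺³(↥W ⧸ (V ∩ W), (Res_W C̄_S)^{V ∩ W})` (`V ≤ W` open normal in `G_S`) has a multiple `d · c` with `p ∤ d` killed by the transition to
the trace of a layer subgroup `V̄_M ≤ V` — `c` is moved to a layer `V̄_E ≤ V` (`exists_layerSubgroupS_le`), read in `Hⁿ⁺³(H_E, C_S(E))`
(`relLayerSCohomologyIso`), where `d · (·)` dies in the cyclotomic layer `M` (`exists_coprime_layer_map_res_classModUnits_nsmul_eq_zero`),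
and the square of §1 brings this back to `stepG`.
[cite: Harari2020, §16.3 Lemma 16.20, Remark 17.1][cite: NeukirchSchmidtWingberg2008, VIII §3 (8.3.8)–(8.3.11)] -/
theorem exists_coprime_nsmul_stepG_trace_eq_zero
    (hSp : ∀ v : HeightOneSpectrum (𝓞 K), ((p : ℕ) : 𝓞 K) ∈ v.asIdeal → v ∈ (↑S : Set (HeightOneSpectrum (𝓞 K))))
    (W : Subgroup (GaloisGroupUnramifiedOutside K (↑S : Set (HeightOneSpectrum (𝓞 K)))))
    (V : OpenNormalSubgroup (GaloisGroupUnramifiedOutside K (↑S : Set (HeightOneSpectrum (𝓞 K)))))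
    (hVW : (V : Subgroup (GaloisGroupUnramifiedOutside K (↑S : Set (HeightOneSpectrum (𝓞 K))))) ≤ W) (n : ℕ)
    (c : groupCohomology ((DiscreteRep.invariantsQuotFunctor ℤ
      (DiscreteRep.traceOpenNormalSubgroup W V : Subgroup W)).obj ((DiscreteRep.resD ℤ W).obj (classBarSD K S))) (n + 3)) :
    ∃ (V' : OpenNormalSubgroup (GaloisGroupUnramifiedOutside K (↑S : Set (HeightOneSpectrum (𝓞 K)))))
      (hV' : (V' : Subgroup (GaloisGroupUnramifiedOutside K (↑S : Set (HeightOneSpectrum (𝓞 K))))) ≤ V) (d : ℕ),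
      p.Coprime d ∧
        LayerColimit.stepG (DiscreteRep.traceOpenNormalSubgroup W V) (DiscreteRep.traceOpenNormalSubgroup W V')
          (DiscreteRep.traceOpenNormalSubgroup_mono W hV') ((DiscreteRep.resD ℤ W).obj (classBarSD K S)) (n + 3) (d • c) = 0 := by
  -- a layer `V̄_E ≤ V` and the class moved there
  have hV := exists_layerSubgroupS_le S V
  obtain ⟨E, hV'⟩ := hV
  obtain ⟨hE, hEV⟩ := hV'
  have hEW : (layerSubgroupS S E : Subgroup (GaloisGroupUnramifiedOutside K (↑S : Set (HeightOneSpectrum (𝓞 K))))) ≤ W :=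
    hEV.trans hVW
  haveI := E.numberField
  haveI := E.isGalois
  -- the prime-to-`p` part `d` of `#H_E` and the cyclotomic layer `M`
  have hx := exists_coprime_layer_map_res_classModUnits_nsmul_eq_zero p S hSp hE (subgroupImageS S hE W) n
  obtain ⟨d, hd, hx'⟩ := hx
  obtain ⟨M, hx''⟩ := hx'
  obtain ⟨h, hM'⟩ := hx''
  obtain ⟨hM, hkill⟩ := hM'
  haveI := M.numberField
  letI := GalLayer.algebraOfLE h
  haveI := GalLayer.isScalarTower_of_le h
  have hMW : (layerSubgroupS S M : Subgroup (GaloisGroupUnramifiedOutside K (↑S : Set (HeightOneSpectrum (𝓞 K))))) ≤ W :=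
    (layerSubgroupS_anti S h).trans hEW
  -- the restriction `res : H_M → H_E` and the pair morphism `j' : C_S(E) → C_S(M)` over it
  have hπ' : ∀ τ : subgroupImageS S hM W, ((subgroupImageSRes S W h hE hM τ : subgroupImageS S hE W) : E.1 ≃ₐ[K] E.1) =
      GalLayer.resHom h (τ : M.1 ≃ₐ[K] M.1) := fun _ => rfl
  let j' : Rep.res (subgroupImageSRes S W h hE hM)
      (Rep.res (subgroupImageS S hE W).subtype (IdeleCohomology.classModUnitsRep K E.1 S)) ⟶
      Rep.res (subgroupImageS S hM W).subtype (IdeleCohomology.classModUnitsRep K M.1 S) :=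
    Rep.resMap (subgroupImageS S hM W).subtype (IdeleCohomology.classModUnitsInflHom K E.1 M.1 S)
  have hj' : ∀ z : (IdeleCohomology.classModUnitsRep K E.1 S).V,
      j'.hom z = (IdeleCohomology.classModUnitsInflHom K E.1 M.1 S).hom z := fun _ => rfl
  refine ⟨layerSubgroupS S M, (layerSubgroupS_anti S h).trans hEV, d, hd, ?_⟩
  -- `stepG (V) (V̄_M) (d • c) = stepG (V̄_E) (V̄_M) (d • stepG (V) (V̄_E) c)`
  rw [← LayerColimit.stepG_stepG (DiscreteRep.traceOpenNormalSubgroup W V)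
    (DiscreteRep.traceOpenNormalSubgroup W (layerSubgroupS S E)) (DiscreteRep.traceOpenNormalSubgroup_mono W hEV)
    ((DiscreteRep.resD ℤ W).obj (classBarSD K S)) (n + 3) (DiscreteRep.traceOpenNormalSubgroup W (layerSubgroupS S M))
    (DiscreteRep.traceOpenNormalSubgroup_mono W (layerSubgroupS_anti S h)) (d • c), map_nsmul]
  -- under `iso_M` this is `map π' j' (d • iso_E c₁) = 0`
  have h0 : (relLayerSCohomologyIso S hM hMW (n + 3)).hom
      (LayerColimit.stepG (DiscreteRep.traceOpenNormalSubgroup W (layerSubgroupS S E))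
        (DiscreteRep.traceOpenNormalSubgroup W (layerSubgroupS S M))
        (DiscreteRep.traceOpenNormalSubgroup_mono W (layerSubgroupS_anti S h))
        ((DiscreteRep.resD ℤ W).obj (classBarSD K S)) (n + 3)
        (d • LayerColimit.stepG (DiscreteRep.traceOpenNormalSubgroup W V)
          (DiscreteRep.traceOpenNormalSubgroup W (layerSubgroupS S E)) (DiscreteRep.traceOpenNormalSubgroup_mono W hEV)
          ((DiscreteRep.resD ℤ W).obj (classBarSD K S)) (n + 3) c)) = 0 := by
    rw [relLayerSCohomologyIso_hom_stepG_eq_map S h hE hM hEW hMW j' hj' (n + 3), map_nsmul]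
    exact hkill (subgroupImageS S hM W) (subgroupImageSRes S W h hE hM) hπ' j' hj' _
  have h1 := congrArg (relLayerSCohomologyIso S hM hMW (n + 3)).inv h0
  rwa [← ModuleCat.comp_apply, Iso.hom_inv_id, ModuleCat.id_apply, map_zero] at h1

/-! ## §3. Every class of `Extʳ_{C_{↥W}}(ℤ, Res_W C̄_S)`, `r ≥ 3`, is killed by an integer prime to `p` -/

/-- **Harari Lemma 16.20 at `p` for `(G_S, C_S)`, `S ⊇ S_p`, at an open subgroup `W ≤ G_S`**: every class of
`Extʳ_{C_{↥W}}(ℤ, Res_W C̄_S)`, `r ≥ 3`, is killed by an integer prime to `p` (§2 fed into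
`LayerColimit.exists_coprime_nsmul_eq_zero_ext_res_of_forall_trace`).
[cite: Harari2020, §16.3 Lemma 16.20, Remark 16.24 (b), Remark 17.1][cite: NeukirchSchmidtWingberg2008, VIII §3 (8.3.10)–(8.3.11)] -/
theorem exists_coprime_nsmul_eq_zero_ext_triv_res_classBarSD
    (hSp : ∀ v : HeightOneSpectrum (𝓞 K), ((p : ℕ) : 𝓞 K) ∈ v.asIdeal → v ∈ (↑S : Set (HeightOneSpectrum (𝓞 K))))
    (W : Subgroup (GaloisGroupUnramifiedOutside K (↑S : Set (HeightOneSpectrum (𝓞 K)))))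
    (hW : IsOpen (W : Set (GaloisGroupUnramifiedOutside K (↑S : Set (HeightOneSpectrum (𝓞 K)))))) (r : ℕ) (hr : 3 ≤ r)
    (x : Ext (DiscreteRep.triv (Γ := W) ℤ) ((DiscreteRep.resD ℤ W).obj (classBarSD K S)) r) :
    ∃ d : ℕ, p.Coprime d ∧ d • x = 0 := by
  haveI : TotallyDisconnectedSpace (GaloisGroupUnramifiedOutside K (↑S : Set (HeightOneSpectrum (𝓞 K)))) :=
    Literature.GroupTheory.ProfiniteSubquotients.totallyDisconnectedSpace_quotient
      (ramificationSubgroup K (↑S : Set (HeightOneSpectrum (𝓞 K)))) (ramificationSubgroup_isClosed K _)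
  have hr' := Nat.exists_eq_add_of_le' hr
  obtain ⟨n, rfl⟩ := hr'
  exact LayerColimit.exists_coprime_nsmul_eq_zero_ext_res_of_forall_trace W hW (n + 3) (classBarSD K S)
    (fun V hVW c => exists_coprime_nsmul_stepG_trace_eq_zero S p hSp W V hVW n c) x

/-- **Field (8) `ext_triv_coprime` of `DiscreteRep.tateDualityHypothesesAt_of_coprime` for `C = C̄_S`** (`S ⊇ S_p`): at every open
normal `U ≤ G_S`, every class of `Extʳ_{C_{↥U}}(ℤ, Res_U C̄_S)`, `r ≥ 3`, is killed by an integer prime to `p`.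
[cite: Harari2020, §16.3 Lemma 16.20, Remark 16.24 (b), Remark 17.1][cite: NeukirchSchmidtWingberg2008, VIII §3 (8.3.10)–(8.3.11)] -/
theorem ext_triv_coprime_classBarSD
    (hSp : ∀ v : HeightOneSpectrum (𝓞 K), ((p : ℕ) : 𝓞 K) ∈ v.asIdeal → v ∈ (↑S : Set (HeightOneSpectrum (𝓞 K))))
    (U : OpenNormalSubgroup (GaloisGroupUnramifiedOutside K (↑S : Set (HeightOneSpectrum (𝓞 K))))) (r : ℕ) (hr : 3 ≤ r)
    (x : Ext (DiscreteRep.triv (Γ := (U : Subgroup (GaloisGroupUnramifiedOutside K (↑S : Set (HeightOneSpectrum (𝓞 K)))))) ℤ)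
      ((DiscreteRep.resD ℤ (U : Subgroup (GaloisGroupUnramifiedOutside K (↑S : Set (HeightOneSpectrum (𝓞 K)))))).obj
        (classBarSD K S)) r) :
    ∃ d : ℕ, p.Coprime d ∧ d • x = 0 :=
  exists_coprime_nsmul_eq_zero_ext_triv_res_classBarSD S p hSp
    (U : Subgroup (GaloisGroupUnramifiedOutside K (↑S : Set (HeightOneSpectrum (𝓞 K))))) (LayerColimit.coe_isOpen U) r hr x

end IdeleClassBar

end Literature.NumberTheory.GaloisRepresentations

end
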